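import Literature.NumberTheory.DiophantineGeometry.GenEllPotMultPrimesBound
import Literature.NumberTheory.DiophantineGeometry.GenEllPrimesOfPrescribedSize
import Literature.NumberTheory.NumberFields.RamifiedPrimesDifferentBound
import HarnessLib

/-!
# [GenEll] Cor. 4.3 / 4.4: selecting the primes `l°`, `l•`

Topic `NumberTheory/DiophantineGeometry`.  Theorem-only file (no definition, no named fact): the
prime-selection step common to the proofs of [GenEll] Corollaries 4.3 and 4.4 (p. 23), assembled from
Lemma 4.1 (absolute form `GenEll.exists_prime_notMem_le`), the bound
`x_{S°} ≤ x_S + (1 + 3/2) · d · deg_∞` (`GenEll.EllPoint.sum_log_le_five_halves_mul_degree_mul_degInf`)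
and the bound `x_{S•} ≤ x_{S°} + 3 · log |d_L|` (`Literature.NumberTheory.NumberFields.`
`sum_log_le_log_natAbs_discr_of_dvd` and `sum_log_le_of_dvd_ramificationIdx`):

* `GenEll.exists_prime_avoiding_potMult` — there is an absolute `C₁ ≥ 0` such that for every
  presented elliptic curve `P = (E/L)`, every finite `S ⊆ ℕ` and every `h ≥ 0` there is a prime
  `l ∉ S` with `h ≤ l`, `l` prime to the primes of potentially multiplicative reduction and to the
  local heights of `E`, and `l ≤ 2·x_S + 5·d·deg_∞(P) + 8h + C₁` (the prime `l°` of Cor. 4.3 before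
  Theorem 3.8 / Prop. 3.4 are applied);
* `GenEll.exists_prime_avoiding_potMult_ramification` — the same with `l` moreover prime to the
  discriminant `d_L` (i.e. to the rational primes ramifying in `L`) and to all ramification indices
  of `L/ℚ`, and `l ≤ 2·x_S + 5·d·deg_∞(P) + 6·log |d_L| + 8h + C₁` (the prime `l•`;
  `log |d_L| = log N(𝔇_{L/ℚ}) = d · log-diff([E_L])`).

## References

* S. Mochizuki, *Arithmetic elliptic curves in general position*, Math. J. Okayama Univ. 52
  (2010), proof of Corollary 4.3, p. 23. [MochizukiGenEll2010]
-/

noncomputable section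

open NumberField Ideal IsDedekindDomain Finset

namespace Literature.NumberTheory.DiophantineGeometry.GenEll

section primes_in_ideals

variable {F : Type*} [Field F] [NumberField F]

omit [NumberField F] in
/-- If a rational prime `p` lies in a maximal ideal `𝔭` of `𝓞_F`, then `𝔭 ∩ ℤ = (p)`. [folklore] -/
private theorem under_eq_span_of_mem {p : ℕ} (hp : p.Prime) (𝔭 : Ideal (𝓞 F)) [𝔭.IsMaximal]
    (hmem : (p : 𝓞 F) ∈ 𝔭) : 𝔭.under ℤ = Ideal.span {(p : ℤ)} := by
  have hmax : (Ideal.span {(p : ℤ)}).IsMaximal :=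
    Ideal.IsPrime.isMaximal (Ideal.span_singleton_prime (by exact_mod_cast hp.ne_zero) |>.mpr
      (Nat.prime_iff_prime_int.mp hp)) (by simpa using hp.ne_zero)
  refine (hmax.eq_of_le (IsPrime.under ℤ 𝔭).ne_top ?_).symm
  rw [Ideal.span_singleton_le_iff_mem, Ideal.under_def, Ideal.mem_comap, map_natCast]
  exact hmem

/-- If a rational prime `p` lies in a finite prime `v` of `𝓞_F`, then `p ∣ N(v)`. [folklore] -/
private theorem dvd_absNorm_of_mem {p : ℕ} (hp : p.Prime) (v : HeightOneSpectrum (𝓞 F))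
    (hmem : (p : 𝓞 F) ∈ v.asIdeal) : p ∣ absNorm v.asIdeal := by
  haveI := v.isMaximal
  have h2 : (absNorm v.asIdeal : ℤ) ∈ v.asIdeal.under ℤ := by
    rw [Ideal.under_def, Ideal.mem_comap, map_natCast]
    exact Ideal.absNorm_mem v.asIdeal
  rw [under_eq_span_of_mem hp v.asIdeal hmem, Ideal.mem_span_singleton] at h2
  exact_mod_cast h2

/-- Every finite prime `v` of `𝓞_F` contains a rational prime `p₀`, and `N(v)` is a power of it; hence
a rational prime dividing `N(v)` lies in `v`. [folklore] -/
private theorem natCast_mem_of_prime_dvd_absNorm {p : ℕ} (hp : p.Prime) (v : HeightOneSpectrum (𝓞 F))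
    (hdvd : p ∣ absNorm v.asIdeal) : (p : 𝓞 F) ∈ v.asIdeal := by
  haveI := v.isMaximal
  -- the prime `p₀` under `v`
  set I : Ideal ℤ := v.asIdeal.under ℤ with hI
  have hIbot : I ≠ ⊥ := under_ne_bot ℤ (Ideal.IsMaximal.ne_bot_of_isIntegral_int v.asIdeal)
  haveI : I.IsPrime := IsPrime.under ℤ v.asIdeal
  set g : ℤ := Submodule.IsPrincipal.generator I with hg
  have hIg : I = Ideal.span {g} := (Ideal.span_singleton_generator I).symm
  have hg0 : g ≠ 0 := by
    intro h0
    apply hIbot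
    rw [hIg, h0, Ideal.span_singleton_eq_bot]
  have hgprime : Prime g := (Ideal.span_singleton_prime hg0).mp (hIg ▸ ‹I.IsPrime›)
  set p₀ : ℕ := g.natAbs with hp₀
  have hp₀prime : p₀.Prime := Int.prime_iff_natAbs_prime.mp hgprime
  have hIp₀ : I = Ideal.span {(p₀ : ℤ)} := by rw [hIg, hp₀, Int.span_natAbs]
  haveI : v.asIdeal.LiesOver (Ideal.span {(p₀ : ℤ)}) := ⟨by rw [← hIp₀]⟩
  have hpow := Ideal.pow_inertiaDeg p₀ v.asIdeal
  have hpp₀ : p = p₀ := by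
    rw [← hpow] at hdvd
    exact (Nat.prime_dvd_prime_iff_eq hp hp₀prime).mp (hp.dvd_of_dvd_pow hdvd)
  have hmem₀ : (p₀ : ℤ) ∈ I := by rw [hIp₀]; exact Ideal.mem_span_singleton_self _
  rw [hI, Ideal.under_def, Ideal.mem_comap, map_natCast] at hmem₀
  rw [hpp₀]
  exact hmem₀

end primes_in_ideals

/-- Sums of `log` over a union are at most the sum of the sums (the terms are `≥ 0`). [folklore] -/
private theorem sum_log_union_le (A B : Finset ℕ) :
    ∑ p ∈ A ∪ B, Real.log (p : ℝ) ≤ ∑ p ∈ A, Real.log (p : ℝ) + ∑ p ∈ B, Real.log (p : ℝ) := by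
  classical
  rw [← Finset.sum_union_inter]
  have := Finset.sum_nonneg fun q (_ : q ∈ A ∩ B) => Real.log_natCast_nonneg q
  linarith

/-- **The prime `l°` of [GenEll] Cor. 4.3 / 4.4.** There is an absolute constant `C₁ ≥ 0` such that
for every presented elliptic curve `P = (E/L)`, every finite set `S` of natural numbers and every
`h ≥ 0` there is a prime number `l ∉ S` with `h ≤ l` which is prime to the primes of potentially
multiplicative reduction of `E` (`l ∉ v`) as well as to the local heights of `E` (`l ∤ h_v`), and
`l ≤ 2·x_S + 5·(d · deg_∞(P)) + 8h + C₁` — Lemma 4.1 (`M = 1`, `1 + 6ε = 2`) applied to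
`A = S° = S ∪ {p under a prime of pot. mult. reduction} ∪ {p ∣ some local height}`, whose
`x_{S°} ≤ x_S + (1 + 3/2) · d · deg_∞`. [cite: MochizukiGenEll2010, proof of Cor. 4.3, p. 23] -/
theorem exists_prime_avoiding_potMult :
    ∃ C₁ : ℝ, 0 ≤ C₁ ∧ ∀ (P : EllPoint) (S : Finset ℕ) (h : ℝ), 0 ≤ h →
      ∃ l : ℕ, l.Prime ∧ l ∉ S ∧ h ≤ (l : ℝ) ∧
        (∀ v : HeightOneSpectrum (𝓞 P.F), P.IsPotMult v →
            (l : 𝓞 P.F) ∉ v.asIdeal ∧ ¬ ((l : ℤ) ∣ P.localHeight v)) ∧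
        (l : ℝ) ≤ 2 * (∑ p ∈ S, Real.log (p : ℝ)) + 5 * ((P.degree : ℝ) * P.degInf) + 8 * h + C₁ := by
  classical
  obtain ⟨C₁, hC₁, H41⟩ := exists_prime_notMem_le
  refine ⟨C₁, hC₁, fun P S h hh => ?_⟩
  obtain ⟨T, hT⟩ : ∃ T : Finset (HeightOneSpectrum (𝓞 P.F)), ∀ v, v ∈ T ↔ P.IsPotMult v :=
    ⟨P.finite_setOf_isPotMult.toFinset, fun v => P.finite_setOf_isPotMult.mem_toFinset⟩
  -- `S° ∖ S`: the primes under the pot. mult. primes and the primes dividing the local heights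
  obtain ⟨A, hA⟩ : ∃ A : Finset ℕ, ∀ p, p ∈ A ↔
      ∃ v ∈ T, p ∈ (absNorm v.asIdeal).primeFactors ∨ p ∈ (P.localHeight v).toNat.primeFactors :=
    ⟨T.biUnion fun v => (absNorm v.asIdeal).primeFactors ∪ (P.localHeight v).toNat.primeFactors,
      fun p => by simp only [Finset.mem_biUnion, Finset.mem_union]⟩
  obtain ⟨l, hl, hlA, hhl, hle⟩ := H41 h hh (S ∪ A)
  refine ⟨l, hl, fun hS => hlA (Finset.mem_union_left _ hS), hhl, ?_, ?_⟩
  · intro v hv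
    have hvT : v ∈ T := (hT v).mpr hv
    have hpos : 0 < P.localHeight v := hv
    refine ⟨fun hmem => hlA (Finset.mem_union_right _ ((hA l).mpr ⟨v, hvT, Or.inl ?_⟩)),
      fun hdvd => hlA (Finset.mem_union_right _ ((hA l).mpr ⟨v, hvT, Or.inr ?_⟩))⟩
    · rw [Nat.mem_primeFactors]
      refine ⟨hl, dvd_absNorm_of_mem hl v hmem, ?_⟩
      have := NumberField.HeightOneSpectrum.one_lt_absNorm v
      omega
    · rw [Nat.mem_primeFactors]
      refine ⟨hl, ?_, by omega⟩
      have h2 : ((P.localHeight v).toNat : ℤ) = P.localHeight v := Int.toNat_of_nonneg hpos.le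
      rw [← h2] at hdvd
      exact_mod_cast hdvd
  · have hAle : ∑ p ∈ A, Real.log (p : ℝ) ≤ 5 / 2 * ((P.degree : ℝ) * P.degInf) := by
      refine P.sum_log_le_five_halves_mul_degree_mul_degInf A ?_
      intro p hp
      obtain ⟨v, hvT, hp⟩ := (hA p).mp hp
      have hv : P.IsPotMult v := (hT v).mp hvT
      rcases hp with hp | hp
      · rw [Nat.mem_primeFactors] at hp
        exact ⟨hp.1, v, hv, Or.inl (natCast_mem_of_prime_dvd_absNorm hp.1 v hp.2.1)⟩
      · rw [Nat.mem_primeFactors] at hp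
        refine ⟨hp.1, v, hv, Or.inr ?_⟩
        have hpos : 0 < P.localHeight v := hv
        have h2 : ((P.localHeight v).toNat : ℤ) = P.localHeight v := Int.toNat_of_nonneg hpos.le
        rw [← h2]
        exact_mod_cast hp.2.1
    have hsplit := sum_log_union_le S A
    linarith

/-- The set of finite primes of `𝓞_F` with ramification index `≥ 2` over `ℚ` is finite (each divides
the different). [folklore] -/
private theorem finite_setOf_two_le_ramificationIdx (F : Type*) [Field F] [NumberField F] :
    {v : HeightOneSpectrum (𝓞 F) | 2 ≤ v.asIdeal.ramificationIdx ℤ}.Finite := by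
  refine (Ideal.finite_factors (differentIdeal_ne_bot : differentIdeal ℤ (𝓞 F) ≠ ⊥)).subset ?_
  intro v hv
  haveI := v.isMaximal
  have h := Literature.NumberTheory.NumberFields.pow_ramificationIdx_sub_one_dvd_differentIdeal F
    v.asIdeal
  have hv' : 2 ≤ v.asIdeal.ramificationIdx ℤ := hv
  exact (dvd_pow_self _ (by omega)).trans h

/-- **The prime `l•` of [GenEll] Cor. 4.3 / 4.4.** As `exists_prime_avoiding_potMult`, with `l`
moreover prime to the discriminant `d_L` ("prime to the primes of `ℚ` that ramify in `L`") as well as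
to all the ramification indices of `L/ℚ` (`l ∤ e_v` for every finite prime `v`), and
`l ≤ 2·x_S + 5·(d · deg_∞(P)) + 6·log |d_L| + 8h + C₁` — Lemma 4.1 applied to
`A = S• = S° ∪ {p ∣ d_L} ∪ {p ∣ some e_v}`, whose `x_{S•} ≤ x_{S°} + (1 + 1/log 2) · log |d_L|`
(`log |d_L| = log N(𝔇_{L/ℚ}) = d · log-diff([E_L])`; print: `+ 3d · log-diff`).
[cite: MochizukiGenEll2010, proof of Cor. 4.3, p. 23] -/
theorem exists_prime_avoiding_potMult_ramification :
    ∃ C₁ : ℝ, 0 ≤ C₁ ∧ ∀ (P : EllPoint) (S : Finset ℕ) (h : ℝ), 0 ≤ h →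
      ∃ l : ℕ, l.Prime ∧ l ∉ S ∧ h ≤ (l : ℝ) ∧
        (∀ v : HeightOneSpectrum (𝓞 P.F), P.IsPotMult v →
            (l : 𝓞 P.F) ∉ v.asIdeal ∧ ¬ ((l : ℤ) ∣ P.localHeight v)) ∧
        ¬ ((l : ℤ) ∣ NumberField.discr P.F) ∧
        (∀ v : HeightOneSpectrum (𝓞 P.F), ¬ (l ∣ v.asIdeal.ramificationIdx ℤ)) ∧
        (l : ℝ) ≤ 2 * (∑ p ∈ S, Real.log (p : ℝ)) + 5 * ((P.degree : ℝ) * P.degInf) +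
          6 * Real.log ((NumberField.discr P.F).natAbs : ℝ) + 8 * h + C₁ := by
  classical
  obtain ⟨C₁, hC₁, H⟩ := exists_prime_avoiding_potMult
  refine ⟨C₁, hC₁, fun P S h hh => ?_⟩
  obtain ⟨R, hR⟩ : ∃ R : Finset (HeightOneSpectrum (𝓞 P.F)),
      ∀ v, v ∈ R ↔ 2 ≤ v.asIdeal.ramificationIdx ℤ :=
    ⟨(finite_setOf_two_le_ramificationIdx P.F).toFinset,
      fun v => (finite_setOf_two_le_ramificationIdx P.F).mem_toFinset⟩
  have hD : (NumberField.discr P.F).natAbs ≠ 0 := Int.natAbs_ne_zero.mpr (NumberField.discr_ne_zero P.F)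
  -- `S• ∖ S°`: the primes dividing the discriminant and the primes dividing ramification indices
  set A₁ : Finset ℕ := (NumberField.discr P.F).natAbs.primeFactors with hA₁
  obtain ⟨A₂, hA₂⟩ : ∃ A₂ : Finset ℕ, ∀ p, p ∈ A₂ ↔
      ∃ v ∈ R, p ∈ (v.asIdeal.ramificationIdx ℤ).primeFactors :=
    ⟨R.biUnion fun v => (v.asIdeal.ramificationIdx ℤ).primeFactors,
      fun p => by simp only [Finset.mem_biUnion]⟩
  obtain ⟨l, hl, hlA, hhl, hpot, hle⟩ := H P (S ∪ (A₁ ∪ A₂)) h hh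
  refine ⟨l, hl, fun hS => hlA (Finset.mem_union_left _ hS), hhl, hpot, ?_, ?_, ?_⟩
  · intro hdvd
    refine hlA (Finset.mem_union_right _ (Finset.mem_union_left _ ?_))
    rw [hA₁, Nat.mem_primeFactors]
    exact ⟨hl, Int.natCast_dvd.mp hdvd, hD⟩
  · intro v hdvd
    haveI := v.isMaximal
    have he : 0 < v.asIdeal.ramificationIdx ℤ := Ideal.ramificationIdx_pos v.asIdeal ℤ
    by_cases h2 : 2 ≤ v.asIdeal.ramificationIdx ℤ
    · refine hlA (Finset.mem_union_right _ (Finset.mem_union_right _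
        ((hA₂ l).mpr ⟨v, (hR v).mpr h2, ?_⟩)))
      rw [Nat.mem_primeFactors]
      exact ⟨hl, hdvd, he.ne'⟩
    · have h1 : v.asIdeal.ramificationIdx ℤ = 1 := by omega
      rw [h1, Nat.dvd_one] at hdvd
      exact hl.one_lt.ne' hdvd
  · have hA₁le : ∑ p ∈ A₁, Real.log (p : ℝ) ≤ Real.log ((NumberField.discr P.F).natAbs : ℝ) := by
      refine Literature.NumberTheory.NumberFields.sum_log_le_log_natAbs_discr_of_dvd P.F A₁ ?_
      intro p hp
      rw [hA₁, Nat.mem_primeFactors] at hp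
      exact ⟨hp.1, Int.dvd_natAbs.mp (Int.natCast_dvd_natCast.mpr hp.2.1)⟩
    have hA₂le : ∑ p ∈ A₂, Real.log (p : ℝ) ≤
        (Real.log 2)⁻¹ * Real.log (absNorm (differentIdeal ℤ (𝓞 P.F))) := by
      refine Literature.NumberTheory.NumberFields.sum_log_le_of_dvd_ramificationIdx P.F A₂ ?_
      intro p hp
      obtain ⟨v, -, hp⟩ := (hA₂ p).mp hp
      rw [Nat.mem_primeFactors] at hp
      exact ⟨hp.1, v.asIdeal, v.isMaximal, hp.2.1⟩
    rw [NumberField.absNorm_differentIdeal P.F (𝓞 P.F)] at hA₂le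
    have hlogD : 0 ≤ Real.log ((NumberField.discr P.F).natAbs : ℝ) :=
      Real.log_nonneg (by exact_mod_cast Nat.one_le_iff_ne_zero.mpr hD)
    have hinv : (Real.log 2)⁻¹ ≤ 2 := by
      have := Real.log_two_gt_d9
      rw [inv_le_comm₀ (by linarith) (by norm_num)]
      linarith
    have h12 := sum_log_union_le A₁ A₂
    have hsplit := sum_log_union_le S (A₁ ∪ A₂)
    nlinarith

end Literature.NumberTheory.DiophantineGeometry.GenEll
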